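import Literature.Claims.NS.Wu2026
import Mathlib.Analysis.Calculus.BumpFunction.Basic
import Mathlib.MeasureTheory.Integral.DominatedConvergence
import HarnessLib

/-!
# C177 `Wu2026` — SALVAGE, TRUE column: (3.86) and (3.87) PROVED
# (D-0090 NS-CLAIMS, LADDER row rung 3; salvage seat `ns-claims-salvage-p3`)

Kernel proofs of two binders of the composition `Literature.Claims.NS.Wu2026.claim_of_steps'`
(skeleton p558978, typist-10 g6) that are elementary real analysis, stated over the skeleton's own
objects and typed EXACTLY as the binders (no restatement):

* `step_386 : Literature.Claims.NS.Wu2026.Step_386` — (3.86) p.26 l.85–106 «The coarea formula and (3.59)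
  therefore give ∫_{|y|>1} QV·n/|y|² dy = ∫_1^∞ r^{−2} ∫_{S_r} QV·n dS dr = F ∫_1^∞ dr/r² = F» with
  «By Theorem 3.4, F = 0»: from `ZeroRadialFlux (Ioi 1) V Q` (the weak/coarea form of «zero flux through
  a.e. sphere», tested against radial profiles `η ∈ C_c^∞((1,∞))`) and integrability of `Q V·y/|y|³` on
  `{|y| > 1}`, the tangent current `tangentCurrent V P` vanishes. Proof: test with `η_k(r) = ψ_k(r)/r²`,
  `ψ_k` = `radialBump k` (smooth plateau bumps supported in `(1,∞)`, increasing to `𝟙_{(1,∞)}`); the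
  tested integrals are `∫_{|y|>1} ψ_k(|y|) Q V·y/|y|³ dy = 0` and converge to the tangent current by
  dominated convergence.
* `step_387 : Literature.Claims.NS.Wu2026.Step_387` — (3.87) p.26 l.120–138 «Since R_j → ∞,
  0 ≤ Φ_{R_j} ≤ 1, Φ_{R_j}(x) → 1 … dominated convergence gives ∫ Φ_{R_j}|∇v|² dx → ∫|∇v|² dx»:
  `cutoffEnergy ν (R j) v → ν·(dirichlet v).toReal` for every `R_j → ∞`, the density `|∇v|²` being
  continuous (`SereginWangProof.continuous_frobeniusNormSq_fderiv`) and integrable (`dirichlet v < ∞`).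

One auxiliary definition (`radialBump`, a `ContDiffBump` on `ℝ`); standard axioms. Companion of
`Theorems/SoloSalvageWu2026.lean` (Lemma 3.1, p558758).

WHAT THIS IS NOT: not a claim about NS regularity or blow-up; not a claim about any author beyond the
typed locator.
-/

noncomputable section

set_option linter.dupNamespace false

open MeasureTheory Set Function Filter Topology
open scoped ENNReal NNReal RealInnerProductSpace

namespace Summit.NavierStokesRegularity.NavierStokesRegularity.Theorems.Wu2026Salvage

open Literature.Analysis.FluidPDE Literature.Claims.NS.Wu2026

/-! ### (3.86): zero radial flux ⇒ the tangent current vanishes -/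

/-- A radial plateau bump on `ℝ`: centre `k+3`, inner radius `k+2 − 1/(k+2)`, outer radius
`k+2 − 1/(2(k+2))`, so that it is `1` on `[1 + 1/(k+2), 2k+5 − 1/(k+2)]` and supported in
`[1 + 1/(2(k+2)), ∞) ⊂ (1, ∞)`. [cite: Wu2026, (3.58)–(3.59) p.19 l.95–107 (radial test profiles)] -/
def radialBump (k : ℕ) : ContDiffBump ((k : ℝ) + 3) where
  rIn := (k : ℝ) + 2 - 1 / ((k : ℝ) + 2)
  rOut := (k : ℝ) + 2 - 1 / (2 * ((k : ℝ) + 2))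
  rIn_pos := by
    have hk : (2 : ℝ) ≤ (k : ℝ) + 2 := by linarith [(Nat.cast_nonneg k : (0 : ℝ) ≤ k)]
    have : 1 / ((k : ℝ) + 2) ≤ 1 / 2 := by
      rw [div_le_div_iff₀ (by linarith) (by norm_num)]; linarith
    linarith
  rIn_lt_rOut := by
    have hk : (0 : ℝ) < (k : ℝ) + 2 := by positivity
    have : 1 / (2 * ((k : ℝ) + 2)) < 1 / ((k : ℝ) + 2) := by
      rw [div_lt_div_iff₀ (by positivity) hk]; linarith
    linarith

/-- The bump vanishes on `(−∞, 1]`: its support lies in `(1 + 1/(2(k+2)), …)`. [cite: Wu2026, (3.58)–(3.59) p.19] -/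
theorem radialBump_eq_zero_of_le_one (k : ℕ) {r : ℝ} (hr : r ≤ 1) : (radialBump k : ℝ → ℝ) r = 0 := by
  apply (radialBump k).zero_of_le_dist
  show (k : ℝ) + 2 - 1 / (2 * ((k : ℝ) + 2)) ≤ dist r ((k : ℝ) + 3)
  rw [Real.dist_eq, abs_of_nonpos (by linarith)]
  have hk : (0 : ℝ) < 2 * ((k : ℝ) + 2) := by positivity
  have : 0 < 1 / (2 * ((k : ℝ) + 2)) := by positivity
  linarith

/-- The closed support of the bump lies in `(1, ∞)`. [cite: Wu2026, (3.58)–(3.59) p.19] -/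
theorem tsupport_radialBump_subset (k : ℕ) : tsupport (radialBump k : ℝ → ℝ) ⊆ Ioi 1 := by
  rw [(radialBump k).tsupport_eq]
  intro r hr
  rw [Metric.mem_closedBall, Real.dist_eq] at hr
  change |r - ((k : ℝ) + 3)| ≤ (k : ℝ) + 2 - 1 / (2 * ((k : ℝ) + 2)) at hr
  have hpos : 0 < 1 / (2 * ((k : ℝ) + 2)) := by positivity
  have := (abs_le.1 hr).1
  show 1 < r
  linarith

/-- Eventually (in `k`) the bump equals `1` at every fixed `r > 1`. [cite: Wu2026, (3.58)–(3.59) p.19] -/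
theorem eventually_radialBump_eq_one {r : ℝ} (hr : 1 < r) :
    ∀ᶠ k : ℕ in atTop, (radialBump k : ℝ → ℝ) r = 1 := by
  -- choose `K` with `1/(K+2) ≤ r − 1` and `r ≤ K + 3`
  obtain ⟨K₁, hK₁⟩ := exists_nat_gt (1 / (r - 1))
  obtain ⟨K₂, hK₂⟩ := exists_nat_ge r
  filter_upwards [eventually_ge_atTop (max K₁ K₂)] with k hk
  have hk₁ : (K₁ : ℝ) ≤ k := by exact_mod_cast (le_max_left _ _).trans hk
  have hk₂ : (K₂ : ℝ) ≤ k := by exact_mod_cast (le_max_right _ _).trans hk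
  apply (radialBump k).one_of_mem_closedBall
  rw [Metric.mem_closedBall, Real.dist_eq]
  change |r - ((k : ℝ) + 3)| ≤ (k : ℝ) + 2 - 1 / ((k : ℝ) + 2)
  have hr1 : 0 < r - 1 := sub_pos.2 hr
  have hk2 : (0 : ℝ) < (k : ℝ) + 2 := by positivity
  -- `1/(k+2) ≤ r − 1` since `k + 2 > K₁ > 1/(r−1)`
  have hsmall : 1 / ((k : ℝ) + 2) ≤ r - 1 := by
    rw [div_le_iff₀ hk2]
    have h1 : 1 / (r - 1) < (k : ℝ) + 2 := by linarith
    have := (div_lt_iff₀ hr1).1 h1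
    linarith
  rw [abs_le]
  constructor <;> linarith

/-- Smoothness of a product `ψ · g` when `g` is smooth on an open set containing the closed support
of the smooth factor `ψ` (here `g r = (r²)⁻¹`, smooth off `0`, and `tsupport ψ ⊆ (1,∞)`). [folklore] -/
theorem contDiff_mul_inv_sq {ψ : ℝ → ℝ} (hψ : ContDiff ℝ (⊤ : ℕ∞) ψ) (hsupp : tsupport ψ ⊆ Ioi 1) :
    ContDiff ℝ (⊤ : ℕ∞) fun r => ψ r * (r ^ 2)⁻¹ := by
  rw [contDiff_iff_contDiffAt]
  intro r
  by_cases hr : r ∈ tsupport ψ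
  · have hr0 : r ≠ 0 := by
      have := hsupp hr
      exact ne_of_gt (lt_trans one_pos this)
    exact hψ.contDiffAt.mul ((contDiffAt_id.pow 2).inv (pow_ne_zero 2 hr0))
  · have h0 : ψ =ᶠ[𝓝 r] 0 := notMem_tsupport_iff_eventuallyEq.1 hr
    have : (fun r => ψ r * (r ^ 2)⁻¹) =ᶠ[𝓝 r] fun _ => 0 := by
      filter_upwards [h0] with s hs
      simp [hs]
    exact (contDiffAt_const (c := (0 : ℝ))).congr_of_eventuallyEq this

/-- The radial test profiles `η_k(r) = ψ_k(r) r⁻²` are admissible in `ZeroRadialFlux (Ioi 1)`.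
[cite: Wu2026, (3.58)–(3.59) p.19 l.95–107] -/
theorem isTestRad_eta (k : ℕ) :
    IsTestRad (Ioi 1) fun r => (radialBump k : ℝ → ℝ) r * (r ^ 2)⁻¹ := by
  refine ⟨contDiff_mul_inv_sq (radialBump k).contDiff (tsupport_radialBump_subset k), ?_, ?_⟩
  · exact (radialBump k).hasCompactSupport.mul_right
  · exact (tsupport_mul_subset_left (f := (radialBump k : ℝ → ℝ)) (g := fun r : ℝ => (r ^ 2)⁻¹)).trans
      (tsupport_radialBump_subset k)

/-- The exterior region is measurable. [cite: Wu2026, {|y| > 1} p.13] -/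
theorem measurableSet_exterior : MeasurableSet exterior :=
  (isOpen_lt continuous_const continuous_norm).measurableSet

/-- **(3.86) PROVED** — the typed binder `Step_386`: if `Q = P + |V|²/2`, the radial flux of `QV`
vanishes through a.e. sphere `S_r`, `r > 1` (weak/coarea form), and `Q V·y/|y|³` is integrable on
`{|y| > 1}`, then the tangent current `∫_{|y|>1} Q V·y |y|^{-3} dy` is `0`. Proof: test the flux
hypothesis with `η_k(r) = ψ_k(r)/r²`, `ψ_k` radial plateau bumps increasing to `𝟙_{(1,∞)}`; the tested
integrals are `∫_{|y|>1} ψ_k(|y|) Q V·y/|y|³ dy`, which tend to the tangent current by dominated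
convergence. [cite: Wu2026, (3.86) p.26 l.85–106; (3.59) p.19] -/
theorem step_386 : Step_386 := by
  intro V Q P hQ hflux hint
  -- the integrable exterior density
  set g : E3 → ℝ := fun y => Q y * ⟪V y, y⟫ / ‖y‖ ^ 3 with hg
  have htc : tangentCurrent V P = ∫ y in exterior, g y := by
    rw [tangentCurrent, hg, hQ]
    rfl
  -- the tested integrals vanish and equal the cut-off exterior integrals
  have hzero : ∀ k : ℕ, ∫ y in exterior, (radialBump k : ℝ → ℝ) ‖y‖ * g y = 0 := by
    intro k
    have h1 := hflux _ (isTestRad_eta k)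
    have hpt : ∀ y : E3, (radialBump k : ℝ → ℝ) ‖y‖ * (‖y‖ ^ 2)⁻¹ * (Q y * ⟪V y, y⟫ / ‖y‖) =
        (radialBump k : ℝ → ℝ) ‖y‖ * g y := by
      intro y
      rw [hg]
      by_cases hy : ‖y‖ = 0
      · have hy0 : y = 0 := norm_eq_zero.1 hy
        simp [hy0]
      · field_simp
    have h2 : ∫ y, (radialBump k : ℝ → ℝ) ‖y‖ * g y = 0 := by
      rw [← h1]
      exact integral_congr_ae (Eventually.of_forall fun y => (hpt y).symm)
    rw [← h2]
    refine setIntegral_eq_integral_of_forall_compl_eq_zero fun y hy => ?_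
    have hy' : ‖y‖ ≤ 1 := not_lt.1 hy
    rw [radialBump_eq_zero_of_le_one k hy', zero_mul]
  -- dominated convergence on the exterior region
  have hlim : Tendsto (fun k : ℕ => ∫ y in exterior, (radialBump k : ℝ → ℝ) ‖y‖ * g y) atTop
      (𝓝 (∫ y in exterior, g y)) := by
    refine tendsto_integral_of_dominated_convergence (fun y => ‖g y‖) ?_ hint.norm ?_ ?_
    · intro k
      exact (((radialBump k).continuous.comp continuous_norm).aestronglyMeasurable).mul
        hint.aestronglyMeasurable
    · intro k
      refine Eventually.of_forall fun y => ?_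
      rw [norm_mul, Real.norm_eq_abs, abs_of_nonneg ((radialBump k).nonneg)]
      exact mul_le_of_le_one_left (norm_nonneg _) ((radialBump k).le_one)
    · rw [ae_restrict_iff' measurableSet_exterior]
      refine Eventually.of_forall fun y hy => ?_
      have hev := eventually_radialBump_eq_one (r := ‖y‖) hy
      refine (tendsto_const_nhds (x := g y)).congr' ?_
      filter_upwards [hev] with k hk
      rw [hk, one_mul]
  -- the sequence is identically zero
  have hlim0 : Tendsto (fun k : ℕ => ∫ y in exterior, (radialBump k : ℝ → ℝ) ‖y‖ * g y) atTop
      (𝓝 0) := by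
    simp_rw [hzero]
    exact tendsto_const_nhds
  rw [htc]
  exact tendsto_nhds_unique hlim hlim0

/-! ### (3.87): dominated convergence for the cut-off Dirichlet energy -/

/-- `0 ≤ Φ_R ≤ 1` for `R ≥ 0`. [cite: Wu2026, (3.79) p.24 l.91–98] -/
theorem phiR_nonneg_le_one {R : ℝ} (hR : 0 ≤ R) (x : E3) : 0 ≤ PhiR R x ∧ PhiR R x ≤ 1 := by
  unfold PhiR
  split_ifs with h
  · exact ⟨zero_le_one, le_rfl⟩
  · have hx : 0 < ‖x‖ := lt_of_le_of_lt hR (not_le.1 h)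
    exact ⟨div_nonneg hR hx.le, (div_le_one hx).2 (not_le.1 h).le⟩

/-- `Φ_R` is measurable. [cite: Wu2026, (3.79) p.24] -/
theorem measurable_phiR (R : ℝ) : Measurable (PhiR R) := by
  unfold PhiR
  refine Measurable.ite (measurableSet_le continuous_norm.measurable measurable_const)
    measurable_const (measurable_const.div continuous_norm.measurable)

/-- `Φ_{R_j}(x) → 1` as `R_j → ∞`, for every fixed `x`. [cite: Wu2026, (3.87) p.26 l.120–125] -/
theorem tendsto_phiR_one {R : ℕ → ℝ} (hR : Tendsto R atTop atTop) (x : E3) :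
    Tendsto (fun j => PhiR (R j) x) atTop (𝓝 1) := by
  refine (tendsto_const_nhds (x := (1 : ℝ))).congr' ?_
  filter_upwards [hR.eventually (eventually_ge_atTop ‖x‖)] with j hj
  unfold PhiR
  rw [if_pos hj]

/-- **(3.87) PROVED** — the typed binder `Step_387`: along any `R_j → ∞`,
`∫ Φ_{R_j} ν|∇v|² → ν ∫|∇v|² = ν·D` (dominated convergence: `0 ≤ Φ_R ≤ 1`, `Φ_{R_j} → 1`,
`|∇v|² ∈ L¹` since `D < ∞`). [cite: Wu2026, (3.87) p.26 l.120–138] -/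
theorem step_387 : Step_387 := by
  intro ν hν v p hflow hD R hR
  -- the energy density and its integrability
  set e : E3 → ℝ := fun x => frobeniusNormSq (fderiv ℝ v x) with he
  have he_nonneg : ∀ x, 0 ≤ e x := fun x => frobeniusNormSq_nonneg _
  have he_cont : Continuous e := SereginWangProof.continuous_frobeniusNormSq_fderiv hflow.smooth_v
  have he_int : Integrable e := by
    refine ⟨he_cont.aestronglyMeasurable, ?_⟩
    rw [hasFiniteIntegral_iff_ofReal (Eventually.of_forall he_nonneg)]
    exact hD
  have hDreal : (dirichlet v).toReal = ∫ x, e x := by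
    rw [dirichlet, integral_eq_lintegral_of_nonneg_ae (Eventually.of_forall he_nonneg)
      he_cont.aestronglyMeasurable]
  -- eventually `R j ≥ 0`
  have hRpos : ∀ᶠ j in atTop, 0 ≤ R j := hR.eventually (eventually_ge_atTop 0)
  have hlim : Tendsto (fun j => ∫ x, PhiR (R j) x * (ν * e x)) atTop (𝓝 (∫ x, ν * e x)) := by
    refine tendsto_integral_filter_of_dominated_convergence (fun x => ν * e x) ?_ ?_
      (he_int.const_mul ν) ?_
    · exact Eventually.of_forall fun j =>
        ((measurable_phiR (R j)).aestronglyMeasurable).mul (he_int.const_mul ν).aestronglyMeasurable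
    · filter_upwards [hRpos] with j hj
      refine Eventually.of_forall fun x => ?_
      have hb := phiR_nonneg_le_one hj x
      have hνe : 0 ≤ ν * e x := mul_nonneg hν.le (he_nonneg x)
      rw [norm_mul, Real.norm_eq_abs, abs_of_nonneg hb.1, Real.norm_eq_abs, abs_of_nonneg hνe]
      exact mul_le_of_le_one_left hνe hb.2
    · exact Eventually.of_forall fun x => by
        simpa using (tendsto_phiR_one hR x).mul (tendsto_const_nhds (x := ν * e x))
  have hfin : ∫ x, ν * e x = ν * (dirichlet v).toReal := by
    rw [integral_const_mul, hDreal]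
  unfold cutoffEnergy
  rw [← hfin]
  exact hlim

end Summit.NavierStokesRegularity.NavierStokesRegularity.Theorems.Wu2026Salvage

end

-- WHAT THIS IS NOT: not a claim about NS regularity or blow-up; not a claim about any author beyond the typed locator.
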